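/-
Copyright (c) 2026 the pub-hodgecm-mathlib formalisation cell (harness21).  Prover seat hodgecm-mathlib-LH4-p10 (g9) (valve hand), Track B «K2-LIT»,
#184♮ = hLiu418 = `stmt-HodgeConjecture-24832`; socket #41, KIND W, organ «Φ6b-ind» (R3)-G6 (KW desk F0P2-p08 (g4) DEAL 2026-09-05T01:45:10Z, re-placed from
LH4-p08 (g11); organ architect K2E4-p11 (g9); G5 producer K2E4-p10 (g10)): THE INDEFINITE GROWTH FACE in the 2b′ quantifier order, HYPOTHESIS-FIRST on the
jet-continuation-with-growth letter `hJetGrowth` ((R3)-G5).  The indefinite twin of ★ LH4-p08 `K2LiuKindWArchWhittakerGrowthAtOnePic`; the road of ★ K2E4-p11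
`K2LiuKindWArchIndefiniteLetter`.  THEOREMS ONLY (no `def`, no `instance`, no notation, no named-fact hypothesis, no `sorry`).
-/
import Summits.HodgeConjecture.HodgeConjecture.Theorems.K2LiuKindWArchWhittakerGrowthAtOnePic   -- ★ LH4-p08 2b′ engine (brings ★ 2b letters `levi_letters_unique`, `norm_archChar_eq_one`, …)
import Summits.HodgeConjecture.HodgeConjecture.Theorems.K2LiuKindWArchIndefiniteLetter          -- ★ K2E4-p11: `det_re_conjTranspose_mul_mul_neg`, the fallback head, ★ (V-4b)
import Summits.HodgeConjecture.HodgeConjecture.Theorems.K2LiuKindWArchBlockGrowthConversion      -- ★ K2Liu-p11: `exp_neg_mul_le_of_le_mul`, `one_add_rpow_le_of_le_mul`, `det_levi_index_ne_zero` (+ ★ (3b))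
import Summits.HodgeConjecture.HodgeConjecture.Theorems.K2LiuHermTwoXiSeriesLattice              -- ★ `one_add_rpow_neg_le_two_mul`
import HarnessLib

/-!
# Crux `HLiu418`, socket #41, KIND W — (R3)-G6 FILE 1 `K2LiuKindWArchWhittakerGrowthIndefExplicit`: THE TWISTED UNIPOTENT INTEGRAL AT AN INDEFINITE INDEX WRITTEN
# OUT AT A SIEGEL-FORM DECOMPOSITION, WITH ONE UNIFORM GROWTH LETTER FOR ITS JET SUM, modulo the jet-growth letter `hJetGrowth` (the engine of the G6 head)

Cell `hodgecm-mathlib`, crux item hLiu418 = `stmt-HodgeConjecture-24832` (helper lane `--supports … --as helper`, count-neutral); squad K2, KW line.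
THE FACE PAID (architect K2E4-p11 (g9) (R3) census 01:29:58Z (1); = ★ 2b′ `exists_growth_constants_of_posDef_pic`'s conclusion with `hidx.PosDef` ↦
`hidxᴴ = hidx ∧ re det hidx < 0`, generic picture predicate `Pic` as ★ 2b′): a FAMILY `Ew : (hidx, g) ↦ Ew hidx g`, holomorphic on `{0 < re}` with the twisted-integral formula on some
`{s₀ < re}` for EVERY hermitian indefinite index and EVERY `g ∈ U(J)`, and `∀ z, 0 < re z → ∃ Cg cg N N' r` (BEFORE `∀ hidx ∀ g`) with, for every Siegel-form decomposition
`diag(C,−B)·g = n(X₀)·diag(R,R⁻¹)` and `dist s z < r`: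
  `‖Ew hidx g s‖ ≤ Cg·‖det R‖^{2−2re s}·e^{−cg·T₂}·(1+T₂)^N·(1+‖det(R h₁ R)‖^{−N′})`, `h₁ = C⁻ᴴ·hidx·C⁻¹`, `T₂ = Σ_{ab}‖(R h₁ R)_{ab}‖`.
THE RESIDUAL LETTER, FIRST ((R3)-G5, K2E4-p10 (g10)'s `hJet_holds_growth`, `Θ` first, `F` a family in `h`):
  `hJetGrowth : ∀ Θ, Θᴴ = Θ → ∀ e a b, ∃ F s₀, (∀ h, hᴴ = h → re det h < 0 → hol (F h) {0<re} ∧ ∀ s, s₀ < re s → F h s = (d∕dt)^e ξ(1, h + tΘ; a+s, b+s)|₀) ∧`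
  `   ∀ z, 0 < re z → ∃ C c Np N' r, … ∀ h, hᴴ = h → re det h < 0 → ∀ s, dist s z < r → ‖F h s‖ ≤ C·e^{−c·T h}·(1+T h)^Np·(1+‖det h‖^{−N'})`, `T h = Σ‖h_ab‖`.
THE ROAD (★ except `hJetGrowth`): ★ (V-4b) `exists_whittaker_eq_sum_iteratedDeriv_hLine_uniform P(1) k` writes `W_{h₂}(s; f) = Σ_{j∈J} κ_j·jet_j(h₂)(s)` for EVERY hermitian
`h₂` with ONE finite `J` (K-picture `P(1)` of the un-translated sections, fixed once); `hJetGrowth` continues each jet with uniform growth; §1 merges the FINITE family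
(`Cg := 2·Σ_j‖κ_j‖C_j`, `cg := (1+Σ_j c_j⁻¹)⁻¹`, `N := Σ_j Np_j`, `N' := Σ_j N'_j`, `r := (1+Σ_j r_j⁻¹)⁻¹`; ★ `one_add_rpow_neg_le_two_mul`) and re-runs ★ 2b′ §1's Steps A–D at
`u₀ = 1`; §2 is ★ 2b′ §2 with the sign clause (congruence-invariant, ★ `det_re_conjTranspose_mul_mul_neg`), the non-Siegel-form branch falling back to ★
`K2LiuKindWArchIndefiniteLetter.exists_twistedWhittaker_continuation_of_indef` (its `hJet` read off `hJetGrowth`), and the decomposition-uniformity step through a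
unitary `κ` (★ `levi_letters_unique`): `det` is invariant and the ENTRY SUM is two-sided comparable, `T₂(κᴴ h κ) ≤ 4·T₂(h)` (★ `entrySum_mul_mul_le`,
Mathlib `entry_norm_bound_of_unitary`) — so `cg ↦ cg∕4`, `Cg ↦ 4^N·Cg` (★ `exp_neg_mul_le_of_le_mul`, ★ `one_add_rpow_le_of_le_mul`).
* §1 `norm_sum_jets_le` (the finite merge), **`twistedWhittaker_indef_explicit_of_siegelForm`** (the engine; the HEAD `exists_growth_constants_of_indef_at_one` — ★ 2b′ §2's
  twin with the decomposition-uniformity step — is the sibling file `K2LiuKindWArchWhittakerGrowthIndef`).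
[Shimura1982, §3 Thm. 3.1, §4 Thm. 4.2] [Shimura1997, §16.4, §18.4] [KudlaRallis1994, §1].
HONEST LABEL.  Count-neutral helper; (R3) stays OPEN until G4∕G5 land (`hJetGrowth` is BY VALUE here): `HC_CM` is proved only modulo the 7 printed citations
(2 remaining named inputs: hLiu418 = `stmt-HodgeConjecture-24832`, h413 = `stmt-HodgeConjecture-24833`) until rung 0 closes.
-/

set_option autoImplicit false
set_option linter.dupNamespace false -- the mandated namespace repeats `HodgeConjecture.HodgeConjecture`

noncomputable section

open Complex Matrix MeasureTheory
open scoped ComplexConjugate ComplexOrder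
open Literature.NumberTheory.ModularForms.SiegelUpperHalfSpace (moeb moeb_one)

namespace Summit.HodgeConjecture.HodgeConjecture.Cruxes.HLiu418.K2LiuKindWArchWhittakerGrowthIndefExplicit

open Summit.HodgeConjecture.HodgeConjecture.Cruxes.HLiu418.K2LiuHermTwoGammaDefs (hermTwo hermTwo_eq_of_isHermitian)
open Summit.HodgeConjecture.HodgeConjecture.Cruxes.HLiu418.K2LiuHermTwoConfluentXiDefs (xiTwo)
open Summit.HodgeConjecture.HodgeConjecture.Cruxes.HLiu418.K2LiuHermTwoEtaDefs (hermTwo_add)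
open Summit.HodgeConjecture.HodgeConjecture.Cruxes.HLiu418.K2LiuHermitianTubeCocycle (mul_mem_UJ)
open Summit.HodgeConjecture.HodgeConjecture.Cruxes.HLiu418.K2LiuArchInducedTubeDefs
open Summit.HodgeConjecture.HodgeConjecture.Cruxes.HLiu418.K2LiuU22CompactPictureDefs
open Summit.HodgeConjecture.HodgeConjecture.Cruxes.HLiu418.K2LiuArchWhittakerLeviEquivariance
open Summit.HodgeConjecture.HodgeConjecture.Cruxes.HLiu418.K2LiuArchIntertwiningScalarValue (integral_hermOfReal_eq)
open Summit.HodgeConjecture.HodgeConjecture.Cruxes.HLiu418.K2LiuArchBlockOfFrame (antidiag_letters antidiag_eq_J_mul_levi levi_mul_transl)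
open Summit.HodgeConjecture.HodgeConjecture.Cruxes.HLiu418.K2LiuKFiniteSectionWhittakerAsXiDerivatives (exists_whittaker_eq_sum_iteratedDeriv_hLine_uniform)
open Summit.HodgeConjecture.HodgeConjecture.Cruxes.HLiu418.K2LiuKindWArchWhittakerGrowth (norm_cexp_trace_mul_of_isHermitian norm_archChar_eq_one levi_letters_unique)
open Summit.HodgeConjecture.HodgeConjecture.Cruxes.HLiu418.K2LiuKindWArchIndefiniteLetter (det_re_conjTranspose_mul_mul_neg exists_twistedWhittaker_continuation_of_indef)
open Summit.HodgeConjecture.HodgeConjecture.Cruxes.HLiu418.K2LiuKindWArchIwasawaComparability (entrySum_mul_mul_le)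
open Summit.HodgeConjecture.HodgeConjecture.Cruxes.HLiu418.K2LiuKindWArchBlockGrowthConversion (exp_neg_mul_le_of_le_mul one_add_rpow_le_of_le_mul det_levi_index_ne_zero)
open Summit.HodgeConjecture.HodgeConjecture.Cruxes.HLiu418.K2LiuHermTwoXiSeriesLattice (one_add_rpow_neg_le_two_mul)

/-! ## §1 The finite merge of the jets' growth letters and the explicit letter at a Siegel-form decomposition -/

/-- **FINITE MERGE OF GROWTH LETTERS.**  A finite family `j ∈ J` of bounds `‖F_j‖ ≤ C_j·e^{−c_j T}·(1+T)^{Np_j}·(1+D^{−N'_j})` (`T ≥ 0`, `D > 0`, `C_j ≥ 0`, `c_j > 0`,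
`Np_j, N'_j ≥ 0`) gives `‖Σ_j κ_j F_j‖ ≤ (2·Σ_j ‖κ_j‖C_j)·e^{−cg·T}·(1+T)^N·(1+D^{−N'})` with `cg := (1+Σ_j c_j⁻¹)⁻¹ ≤ c_j`, `N := Σ_j Np_j`, `N' := Σ_j N'_j`
(★ `one_add_rpow_neg_le_two_mul` merges the blow-up exponents upwards with a factor `2`). [folklore] -/
theorem norm_sum_jets_le {ι : Type*} (J : Finset ι) (κ F : ι → ℂ) (Cf cf Npf N'f : ι → ℝ) {T D : ℝ} (hT : 0 ≤ T) (hD : 0 < D)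
    (hC : ∀ j ∈ J, 0 ≤ Cf j) (hc : ∀ j ∈ J, 0 < cf j) (hNp : ∀ j ∈ J, 0 ≤ Npf j) (hN' : ∀ j ∈ J, 0 ≤ N'f j)
    (hb : ∀ j ∈ J, ‖F j‖ ≤ Cf j * Real.exp (-(cf j * T)) * (1 + T) ^ Npf j * (1 + D ^ (-N'f j))) :
    ‖∑ j ∈ J, κ j * F j‖ ≤ (2 * ∑ j ∈ J, ‖κ j‖ * Cf j) * Real.exp (-((1 + ∑ j ∈ J, (cf j)⁻¹)⁻¹ * T)) * (1 + T) ^ (∑ j ∈ J, Npf j) *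
      (1 + D ^ (-(∑ j ∈ J, N'f j))) := by
  set cg : ℝ := (1 + ∑ j ∈ J, (cf j)⁻¹)⁻¹ with hcg
  set N : ℝ := ∑ j ∈ J, Npf j with hNdef
  set N' : ℝ := ∑ j ∈ J, N'f j with hN'def
  have hsum0 : 0 ≤ ∑ j ∈ J, (cf j)⁻¹ := Finset.sum_nonneg fun j hj => (inv_pos.2 (hc j hj)).le
  have hcg0 : 0 < cg := by rw [hcg]; positivity
  have hcgle : ∀ j ∈ J, cg ≤ cf j := fun j hj => by
    rw [hcg]
    refine inv_le_of_inv_le₀ (hc j hj) ?_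
    have := Finset.single_le_sum (f := fun j => (cf j)⁻¹) (fun j hj => (inv_pos.2 (hc j hj)).le) hj
    linarith
  have hNle : ∀ j ∈ J, Npf j ≤ N := fun j hj => Finset.single_le_sum (f := Npf) (fun j hj => hNp j hj) hj
  have hN'le : ∀ j ∈ J, N'f j ≤ N' := fun j hj => Finset.single_le_sum (f := N'f) (fun j hj => hN' j hj) hj
  have h1T : 1 ≤ 1 + T := by linarith
  -- per term
  have hterm : ∀ j ∈ J, ‖κ j * F j‖ ≤ (‖κ j‖ * Cf j) * (2 * (Real.exp (-(cg * T)) * (1 + T) ^ N * (1 + D ^ (-N')))) := by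
    intro j hj
    rw [norm_mul]
    have hexp : Real.exp (-(cf j * T)) ≤ Real.exp (-(cg * T)) := by
      rw [Real.exp_le_exp, neg_le_neg_iff]; exact mul_le_mul_of_nonneg_right (hcgle j hj) hT
    have hpow : (1 + T) ^ Npf j ≤ (1 + T) ^ N := Real.rpow_le_rpow_of_exponent_le h1T (hNle j hj)
    have hbl : 1 + D ^ (-N'f j) ≤ 2 * (1 + D ^ (-N')) := one_add_rpow_neg_le_two_mul hD (hN' j hj) (hN'le j hj)
    have hF : ‖F j‖ ≤ Cf j * (2 * (Real.exp (-(cg * T)) * (1 + T) ^ N * (1 + D ^ (-N')))) := by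
      refine (hb j hj).trans ?_
      have h0 : 0 ≤ Cf j * Real.exp (-(cg * T)) * (1 + T) ^ N := by
        have := hC j hj; positivity
      calc Cf j * Real.exp (-(cf j * T)) * (1 + T) ^ Npf j * (1 + D ^ (-N'f j))
          ≤ Cf j * Real.exp (-(cg * T)) * (1 + T) ^ N * (1 + D ^ (-N'f j)) := by
            have := hC j hj
            gcongr
        _ ≤ Cf j * Real.exp (-(cg * T)) * (1 + T) ^ N * (2 * (1 + D ^ (-N'))) := mul_le_mul_of_nonneg_left hbl h0
        _ = _ := by ring
    calc ‖κ j‖ * ‖F j‖ ≤ ‖κ j‖ * (Cf j * (2 * (Real.exp (-(cg * T)) * (1 + T) ^ N * (1 + D ^ (-N'))))) :=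
          mul_le_mul_of_nonneg_left hF (norm_nonneg _)
      _ = _ := by ring
  calc ‖∑ j ∈ J, κ j * F j‖ ≤ ∑ j ∈ J, ‖κ j * F j‖ := norm_sum_le _ _
    _ ≤ ∑ j ∈ J, (‖κ j‖ * Cf j) * (2 * (Real.exp (-(cg * T)) * (1 + T) ^ N * (1 + D ^ (-N')))) := Finset.sum_le_sum hterm
    _ = (2 * ∑ j ∈ J, ‖κ j‖ * Cf j) * Real.exp (-(cg * T)) * (1 + T) ^ N * (1 + D ^ (-N')) := by rw [← Finset.sum_mul]; ring

/-- **THE TWISTED UNIPOTENT INTEGRAL AT AN INDEFINITE INDEX WRITTEN OUT, SIEGEL-FORM DECOMPOSITION SUPPLIED (`u₀ = 1`), MODULO `hJetGrowth`.**  The K-picture polynomial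
`P := hKpic 1`, ★ (V-4b)'s finite jet decomposition `(J, κ, m, n, s₀)` and the jets' continuations-with-growth are obtained ONCE; `FJ h s := Σ_{j∈J} κ_j·F_j h s` is holomorphic on
`{0 < re}` for every hermitian indefinite `h`, obeys ONE uniform growth letter (§1 merge), and for EVERY `g ∈ U(J)`, EVERY decomposition `diag(C,−B)·g = n(X₀)·diag(R,R⁻¹)`
(`X₀` hermitian, `R` hermitian invertible) and every section with picture predicate `Pic` at `s₀ < re s` (generic `Pic`, as ★ 2b′):
`∫ F(x·n(b)·g)·eb(b) db = 8⁻¹·‖det C‖⁻⁴·e(tr(h₁X₀))·χ_k(det R⁻¹)·‖det R‖^{2−2s}·FJ (Rᴴ h₁ R) s`, `h₁ = C⁻ᴴ·hidx·C⁻¹` (★ 2b′ §1's Steps A–D; ★ (V-4b) at the hermitian `Rᴴ h₁ R`).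
[cite: Shimura1997, §16.4, §18.4] [cite: Shimura1982, §4 Thm. 4.2] [cite: KudlaRallis1994, §1] -/
theorem twistedWhittaker_indef_explicit_of_siegelForm
    (hJetGrowth : ∀ Θ : Matrix (Fin 2) (Fin 2) ℂ, Θᴴ = Θ → ∀ (e : ℕ) (a b : ℂ),
      ∃ (F : Matrix (Fin 2) (Fin 2) ℂ → ℂ → ℂ) (s₀ : ℝ),
        (∀ h : Matrix (Fin 2) (Fin 2) ℂ, hᴴ = h → h.det.re < 0 → DifferentiableOn ℂ (F h) {s : ℂ | 0 < s.re} ∧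
          ∀ s : ℂ, s₀ < s.re → F h s = iteratedDeriv e (fun t : ℝ => xiTwo 1 (h + (t : ℂ) • Θ) (a + s) (b + s)) 0) ∧
        ∀ z : ℂ, 0 < z.re → ∃ C c Np N' r : ℝ, 0 ≤ C ∧ 0 < c ∧ 0 ≤ Np ∧ 0 ≤ N' ∧ 0 < r ∧
          ∀ h : Matrix (Fin 2) (Fin 2) ℂ, hᴴ = h → h.det.re < 0 → ∀ s : ℂ, dist s z < r →
            ‖F h s‖ ≤ C * Real.exp (-(c * ∑ a, ∑ b, ‖h a b‖)) * (1 + ∑ a, ∑ b, ‖h a b‖) ^ Np * (1 + ‖h.det‖ ^ (-N')))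
    (k : ℤ) (Pic : ℂ → (Matrix (Fin 2 ⊕ Fin 2) (Fin 2 ⊕ Fin 2) ℂ → ℂ) → Prop) {B C : Matrix (Fin 2) (Fin 2) ℂ}
    (hx : (fromBlocks 0 B C 0 : Matrix (Fin 2 ⊕ Fin 2) (Fin 2 ⊕ Fin 2) ℂ)ᴴ * Matrix.J (Fin 2) ℂ * (fromBlocks 0 B C 0 : Matrix (Fin 2 ⊕ Fin 2) (Fin 2 ⊕ Fin 2) ℂ) =
      Matrix.J (Fin 2) ℂ)
    (hKpic : ∀ k₀ : Matrix (Fin 2 ⊕ Fin 2) (Fin 2 ⊕ Fin 2) ℂ, k₀ᴴ * Matrix.J (Fin 2) ℂ * k₀ = Matrix.J (Fin 2) ℂ →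
      moeb k₀ (I • (1 : Matrix (Fin 2) (Fin 2) ℂ)) = I • 1 →
      ∃ P : MvPolynomial (((Fin 2 ⊕ Fin 2) × (Fin 2 ⊕ Fin 2)) ⊕ ((Fin 2 ⊕ Fin 2) × (Fin 2 ⊕ Fin 2))) ℂ,
        ∀ (s : ℂ) (F : Matrix (Fin 2 ⊕ Fin 2) (Fin 2 ⊕ Fin 2) ℂ → ℂ), IsArchSiegelSection (fun z : ℂ => (conj z / ((‖z‖ : ℝ) : ℂ)) ^ k) s F →
          Pic s F →
          ∀ u : Matrix (Fin 2 ⊕ Fin 2) (Fin 2 ⊕ Fin 2) ℂ, uᴴ * Matrix.J (Fin 2) ℂ * u = Matrix.J (Fin 2) ℂ → moeb u (I • (1 : Matrix (Fin 2) (Fin 2) ℂ)) = I • 1 →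
            F (u * k₀) = MvPolynomial.eval (Sum.elim (fun pq => u pq.1 pq.2) (fun pq => conj (u pq.1 pq.2))) P) :
    ∃ (FJ : Matrix (Fin 2) (Fin 2) ℂ → ℂ → ℂ) (s₀ : ℝ),
      (∀ h : Matrix (Fin 2) (Fin 2) ℂ, hᴴ = h → h.det.re < 0 → DifferentiableOn ℂ (FJ h) {s : ℂ | 0 < s.re}) ∧
      (∀ z : ℂ, 0 < z.re → ∃ Cg cg N N' r : ℝ, 0 ≤ Cg ∧ 0 < cg ∧ 0 ≤ N ∧ 0 ≤ N' ∧ 0 < r ∧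
        ∀ h : Matrix (Fin 2) (Fin 2) ℂ, hᴴ = h → h.det.re < 0 → ∀ s : ℂ, dist s z < r →
          ‖FJ h s‖ ≤ Cg * Real.exp (-(cg * ∑ a, ∑ b, ‖h a b‖)) * (1 + ∑ a, ∑ b, ‖h a b‖) ^ N * (1 + ‖h.det‖ ^ (-N'))) ∧
      ∀ hidx : Matrix (Fin 2) (Fin 2) ℂ, hidxᴴ = hidx → hidx.det.re < 0 →
      ∀ eb : Matrix (Fin 2) (Fin 2) ℂ → ℂ, (∀ b, eb b = cexp (-(2 * Real.pi * I) * (hidx * b).trace)) →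
      ∀ g : Matrix (Fin 2 ⊕ Fin 2) (Fin 2 ⊕ Fin 2) ℂ, gᴴ * Matrix.J (Fin 2) ℂ * g = Matrix.J (Fin 2) ℂ →
        ∀ (X₀ R : Matrix (Fin 2) (Fin 2) ℂ), X₀ᴴ = X₀ → Rᴴ = R → IsUnit R.det →
          (fromBlocks C 0 0 (-B) : Matrix (Fin 2 ⊕ Fin 2) (Fin 2 ⊕ Fin 2) ℂ) * g = fromBlocks 1 X₀ 0 1 * fromBlocks R 0 0 R⁻¹ →
          ∀ s : ℂ, s₀ < s.re →
            ∀ F : Matrix (Fin 2 ⊕ Fin 2) (Fin 2 ⊕ Fin 2) ℂ → ℂ, IsArchSiegelSection (fun z : ℂ => (conj z / ((‖z‖ : ℝ) : ℂ)) ^ k) s F →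
              Pic s F →
              ∫ r : Fin 2 → Fin 2 → ℝ, F ((fromBlocks 0 B C 0 : Matrix (Fin 2 ⊕ Fin 2) (Fin 2 ⊕ Fin 2) ℂ) * fromBlocks 1 (hermOfReal r) 0 1 * g) * eb (hermOfReal r) =
                (1 / 8 : ℂ) * (((((‖C.det‖ : ℝ) : ℂ) ^ 4)⁻¹) * (cexp ((2 * Real.pi * I) * (((C⁻¹)ᴴ * hidx * C⁻¹) * X₀).trace) *
                  ((fun z : ℂ => (conj z / ((‖z‖ : ℝ) : ℂ)) ^ k) R⁻¹.det * (((‖R.det‖ : ℝ) : ℂ) ^ (2 - 2 * s) * FJ (Rᴴ * ((C⁻¹)ᴴ * hidx * C⁻¹) * R) s)))) := by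
  classical
  -- the K-picture polynomial of the UN-translated sections, ★ (V-4b)'s jet decomposition, and the jets' continuations — ONCE
  have h1J : (1 : Matrix (Fin 2 ⊕ Fin 2) (Fin 2 ⊕ Fin 2) ℂ)ᴴ * Matrix.J (Fin 2) ℂ * 1 = Matrix.J (Fin 2) ℂ := by
    rw [conjTranspose_one, Matrix.one_mul, Matrix.mul_one]
  obtain ⟨P, hP1⟩ := hKpic 1 h1J (moeb_one _)
  obtain ⟨J, κ, m, n, s₀, hV⟩ := exists_whittaker_eq_sum_iteratedDeriv_hLine_uniform P k
  choose Fj s₁ hFj hFjgr using fun j : (Σ _ : ((Fin 2 × Fin 2) ⊕ (Fin 2 × Fin 2)) →₀ ℕ, {M : Matrix (Fin 2) (Fin 2) ℂ // M.IsHermitian} × ℕ) =>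
    hJetGrowth (j.2.1 : Matrix (Fin 2) (Fin 2) ℂ) j.2.1.2 j.2.2 (1 - (k : ℂ) / 2 + (m j : ℂ)) (1 + (k : ℂ) / 2 + (n j : ℂ))
  refine ⟨fun h s => ∑ j ∈ J, κ j * Fj j h s, max s₀ (∑ j ∈ J, max (s₁ j) 0), ?_, ?_,
    fun hidx hherm hind eb heb g _ X₀ R hX₀ hR hRu hdec s hs F hF hFQ => ?_⟩
  · -- holomorphy
    intro h hh hd
    exact DifferentiableOn.fun_sum fun j _ => (differentiableOn_const _).mul ((hFj j h hh hd).1)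
  · -- the uniform growth letter: finite merge of the jets' letters at `z`
    intro z hz
    choose Cf cf Npf N'f rf hCf hcf hNpf hN'f hrf hb using fun j : (Σ _ : ((Fin 2 × Fin 2) ⊕ (Fin 2 × Fin 2)) →₀ ℕ,
      {M : Matrix (Fin 2) (Fin 2) ℂ // M.IsHermitian} × ℕ) => hFjgr j z hz
    have hsumr : 0 ≤ ∑ j ∈ J, (rf j)⁻¹ := Finset.sum_nonneg fun j _ => (inv_pos.2 (hrf j)).le
    have hsumc : 0 ≤ ∑ j ∈ J, (cf j)⁻¹ := Finset.sum_nonneg fun j _ => (inv_pos.2 (hcf j)).le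
    refine ⟨2 * ∑ j ∈ J, ‖κ j‖ * Cf j, (1 + ∑ j ∈ J, (cf j)⁻¹)⁻¹, ∑ j ∈ J, Npf j, ∑ j ∈ J, N'f j, (1 + ∑ j ∈ J, (rf j)⁻¹)⁻¹,
      mul_nonneg zero_le_two (Finset.sum_nonneg fun j _ => mul_nonneg (norm_nonneg _) (hCf j)), inv_pos.2 (by linarith),
      Finset.sum_nonneg fun j _ => hNpf j, Finset.sum_nonneg fun j _ => hN'f j, inv_pos.2 (by linarith), fun h hh hd s hs => ?_⟩
    have hT : 0 ≤ ∑ a, ∑ b, ‖h a b‖ := Finset.sum_nonneg fun _ _ => Finset.sum_nonneg fun _ _ => norm_nonneg _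
    have hD : 0 < ‖h.det‖ := norm_pos_iff.2 fun h0 => by rw [h0, Complex.zero_re] at hd; exact lt_irrefl _ hd
    have hsr : ∀ j ∈ J, dist s z < rf j := fun j hj => by
      refine lt_of_lt_of_le hs (inv_le_of_inv_le₀ (hrf j) ?_)
      have := Finset.single_le_sum (f := fun j => (rf j)⁻¹) (fun j _ => (inv_pos.2 (hrf j)).le) hj
      linarith
    exact norm_sum_jets_le J κ (fun j => Fj j h s) Cf cf Npf N'f hT hD (fun j _ => hCf j) (fun j _ => hcf j) (fun j _ => hNpf j) (fun j _ => hN'f j)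
      fun j hj => hb j h hh hd s (hsr j hj)
  · /- the formula at a Siegel-form decomposition (★ 2b′ §1's Steps A–D at `u₀ = 1`; ★ (V-4b) at `h₂ = Rᴴ h₁ R`) -/
    have hs₀ : s₀ < s.re := lt_of_le_of_lt (le_max_left _ _) hs
    have hs₁ : ∀ j ∈ J, s₁ j < s.re := fun j hj => by
      have h1 : max (s₁ j) 0 ≤ ∑ j ∈ J, max (s₁ j) 0 :=
        Finset.single_le_sum (f := fun j => max (s₁ j) 0) (fun _ _ => le_max_right _ _) hj
      have h2 := le_max_left (s₁ j) 0
      have h3 := le_max_right s₀ (∑ j ∈ J, max (s₁ j) 0)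
      linarith
    obtain ⟨u₀, hu₀def⟩ : ∃ u₀ : Matrix (Fin 2 ⊕ Fin 2) (Fin 2 ⊕ Fin 2) ℂ, u₀ = 1 := ⟨1, rfl⟩
    have hg'eq : (fromBlocks C 0 0 (-B) : Matrix (Fin 2 ⊕ Fin 2) (Fin 2 ⊕ Fin 2) ℂ) * g = fromBlocks 1 X₀ 0 1 * fromBlocks R 0 0 R⁻¹ * u₀ := by
      rw [hu₀def, Matrix.mul_one]; exact hdec
    have hP : ∀ (s : ℂ) (F : Matrix (Fin 2 ⊕ Fin 2) (Fin 2 ⊕ Fin 2) ℂ → ℂ), IsArchSiegelSection (fun z : ℂ => (conj z / ((‖z‖ : ℝ) : ℂ)) ^ k) s F →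
        Pic s F →
        ∀ u : Matrix (Fin 2 ⊕ Fin 2) (Fin 2 ⊕ Fin 2) ℂ, uᴴ * Matrix.J (Fin 2) ℂ * u = Matrix.J (Fin 2) ℂ →
          moeb u (I • (1 : Matrix (Fin 2) (Fin 2) ℂ)) = I • 1 →
          F (u * u₀) = MvPolynomial.eval (Sum.elim (fun pq => u pq.1 pq.2) (fun pq => conj (u pq.1 pq.2))) P := by
      rw [hu₀def]; exact hP1
    /- §0 frame letters -/
    obtain ⟨hCB, hBC⟩ := antidiag_letters hx
    have hC : C.det ≠ 0 := (Matrix.isUnit_det_of_left_inverse hBC).ne_zero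
    have hCu : IsUnit C.det := isUnit_iff_ne_zero.2 hC
    have hCiC : C⁻¹ * C = 1 := Matrix.nonsing_inv_mul C hCu
    have hRRi : R * R⁻¹ = 1 := Matrix.mul_nonsing_inv R hRu
    have had : Rᴴ * R⁻¹ = 1 := by rw [hR, hRRi]
    have hRdet : R.det ≠ 0 := hRu.ne_zero
    /- the two index changes: hermitian, `det.re < 0` -/
    set h₁ : Matrix (Fin 2) (Fin 2) ℂ := (C⁻¹)ᴴ * hidx * C⁻¹ with hh₁
    set h₂ : Matrix (Fin 2) (Fin 2) ℂ := Rᴴ * h₁ * R with hh₂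
    have hCidet : (C⁻¹).det ≠ 0 := (Matrix.isUnit_det_of_right_inverse hCiC).ne_zero
    have hh₁herm : h₁.IsHermitian := Matrix.isHermitian_conjTranspose_mul_mul C⁻¹ (hherm : hidx.IsHermitian)
    have hh₂herm : h₂.IsHermitian := Matrix.isHermitian_conjTranspose_mul_mul R hh₁herm
    have hdet₁ : h₁.det.re < 0 := det_re_conjTranspose_mul_mul_neg hind hCidet
    have hdet₂ : h₂.det.re < 0 := det_re_conjTranspose_mul_mul_neg hdet₁ hRdet
    /- the constants -/
    set χ : ℂ → ℂ := fun z : ℂ => (conj z / ((‖z‖ : ℝ) : ℂ)) ^ k with hχ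
    set K₀ : ℂ := cexp ((2 * Real.pi * I) * (h₁ * X₀).trace) with hK₀
    show _ = (1 / 8 : ℂ) * (((((‖C.det‖ : ℝ) : ℂ) ^ 4)⁻¹) * (K₀ * (χ R⁻¹.det * (((‖R.det‖ : ℝ) : ℂ) ^ (2 - 2 * s) * ∑ j ∈ J, κ j * Fj j h₂ s))))
    /- Steps A–D -/
    set f : Matrix (Fin 2 ⊕ Fin 2) (Fin 2 ⊕ Fin 2) ℂ → ℂ := fun y => F (y * u₀) with hf
    have hfS : IsArchSiegelSection χ s f := isArchSiegelSection_rightTranslate hF u₀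
    have hfK : ∀ u : Matrix (Fin 2 ⊕ Fin 2) (Fin 2 ⊕ Fin 2) ℂ, uᴴ * Matrix.J (Fin 2) ℂ * u = Matrix.J (Fin 2) ℂ →
        moeb u (I • (1 : Matrix (Fin 2) (Fin 2) ℂ)) = I • 1 →
        f u = MvPolynomial.eval (Sum.elim (fun pq => u pq.1 pq.2) (fun pq => conj (u pq.1 pq.2))) P :=
      fun u hu hui => hP s F hF hFQ u hu hui
    have heb₁ : ∀ X : Matrix (Fin 2) (Fin 2) ℂ, eb X = cexp (-(2 * Real.pi * I) * (h₁ * (C * X * Cᴴ)).trace) := by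
      intro X
      rw [heb, trace_mul_conj h₁ C X, hh₁]
      congr 3
      rw [show Cᴴ * ((C⁻¹)ᴴ * hidx * C⁻¹) * C = (C⁻¹ * C)ᴴ * hidx * (C⁻¹ * C) by
        rw [Matrix.conjTranspose_mul]; simp only [Matrix.mul_assoc], hCiC, Matrix.conjTranspose_one, Matrix.one_mul, Matrix.mul_one]
    have e1 : ∀ X : Matrix (Fin 2) (Fin 2) ℂ, (fromBlocks 0 B C 0 : Matrix (Fin 2 ⊕ Fin 2) (Fin 2 ⊕ Fin 2) ℂ) * fromBlocks 1 X 0 1 * g =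
        Matrix.J (Fin 2) ℂ * fromBlocks 1 (C * X * Cᴴ) 0 1 * (fromBlocks C 0 0 (-B) * g) := by
      intro X
      rw [antidiag_eq_J_mul_levi, Matrix.mul_assoc (Matrix.J (Fin 2) ℂ), levi_mul_transl hCB, ← Matrix.mul_assoc (Matrix.J (Fin 2) ℂ),
        Matrix.mul_assoc _ _ g]
    have e2 : ∀ Y : Matrix (Fin 2) (Fin 2) ℂ, Matrix.J (Fin 2) ℂ * fromBlocks 1 Y 0 1 * (fromBlocks C 0 0 (-B) * g) =
        Matrix.J (Fin 2) ℂ * fromBlocks 1 (Y + X₀) 0 1 * fromBlocks R 0 0 R⁻¹ * u₀ := by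
      intro Y
      have hn : (fromBlocks 1 Y 0 1 : Matrix (Fin 2 ⊕ Fin 2) (Fin 2 ⊕ Fin 2) ℂ) * fromBlocks 1 X₀ 0 1 = fromBlocks 1 (Y + X₀) 0 1 := by
        rw [fromBlocks_multiply]; simp [add_comm]
      rw [hg'eq, ← hn]
      simp only [Matrix.mul_assoc]
    set G : Matrix (Fin 2) (Fin 2) ℂ → ℂ := fun Y =>
      F (Matrix.J (Fin 2) ℂ * fromBlocks 1 Y 0 1 * (fromBlocks C 0 0 (-B) * g)) * cexp (-(2 * Real.pi * I) * (h₁ * Y).trace) with hG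
    set c₀ : ℝ × ℂ × ℝ := ((X₀ 0 0).re, X₀ 0 1, (X₀ 1 1).re) with hc₀
    have hX₀c : hermTwo c₀ = X₀ := hermTwo_eq_of_isHermitian hX₀
    set G₂ : ℝ × ℂ × ℝ → ℂ := fun c =>
      f (Matrix.J (Fin 2) ℂ * fromBlocks 1 (hermTwo c) 0 1 * fromBlocks R 0 0 R⁻¹) * cexp (-(2 * Real.pi * I) * (h₁ * hermTwo c).trace) * K₀ with hG₂
    have hAB : ∀ X : Matrix (Fin 2) (Fin 2) ℂ,
        F ((fromBlocks 0 B C 0 : Matrix (Fin 2 ⊕ Fin 2) (Fin 2 ⊕ Fin 2) ℂ) * fromBlocks 1 X 0 1 * g) * eb X = G (C * X * Cᴴ) := by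
      intro X; rw [hG, e1, heb₁]
    have hD : ∀ c : ℝ × ℂ × ℝ, G (hermTwo c) = G₂ (c₀ + c) := by
      intro c
      have hY : hermTwo (c₀ + c) = hermTwo c + X₀ := by rw [hermTwo_add, hX₀c, add_comm]
      simp only [hG, hG₂, hf]
      rw [e2, hY, mul_assoc (F _)]
      congr 1
      rw [hK₀, ← Complex.exp_add]
      congr 1
      rw [Matrix.mul_add, Matrix.trace_add]
      ring
    -- the jets at `h₂`, continued: `Σ_j κ_j · jet_j(s) = Σ_j κ_j · F_j h₂ s`
    have hJ : ∑ j ∈ J, κ j * iteratedDeriv j.2.2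
          (fun t : ℝ => xiTwo 1 (h₂ + (t : ℂ) • (j.2.1 : Matrix (Fin 2) (Fin 2) ℂ)) (s + 1 - k / 2 + m j) (s + 1 + k / 2 + n j)) 0 =
        ∑ j ∈ J, κ j * Fj j h₂ s := by
      refine Finset.sum_congr rfl fun j hj => ?_
      have ea : 1 - (k : ℂ) / 2 + (m j : ℂ) + s = s + 1 - k / 2 + m j := by ring
      have eb' : 1 + (k : ℂ) / 2 + (n j : ℂ) + s = s + 1 + k / 2 + n j := by ring
      rw [((hFj j h₂ hh₂herm.eq hdet₂).2) s (hs₁ j hj), ea, eb']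
    haveI hCvol : ((volume : Measure ℂ).prod (volume : Measure ℝ)).IsAddHaarMeasure := Measure.prod.instIsAddHaarMeasure _ _
    haveI : (volume : Measure (ℝ × ℂ × ℝ)).IsAddHaarMeasure := by
      rw [show (volume : Measure (ℝ × ℂ × ℝ)) = (volume : Measure ℝ).prod ((volume : Measure ℂ).prod (volume : Measure ℝ)) from rfl]
      exact Measure.prod.instIsAddHaarMeasure _ _
    calc ∫ r : Fin 2 → Fin 2 → ℝ, F ((fromBlocks 0 B C 0 : Matrix (Fin 2 ⊕ Fin 2) (Fin 2 ⊕ Fin 2) ℂ) * fromBlocks 1 (hermOfReal r) 0 1 * g) * eb (hermOfReal r)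
        = (1 / 8 : ℂ) * ∫ c : ℝ × ℂ × ℝ, G (C * hermTwo c * Cᴴ) := by
          rw [integral_hermOfReal_eq (fun X => F ((fromBlocks 0 B C 0 : Matrix (Fin 2 ⊕ Fin 2) (Fin 2 ⊕ Fin 2) ℂ) * fromBlocks 1 X 0 1 * g) * eb X)]
          simp only [hAB]
      _ = (1 / 8 : ℂ) * ((((‖C.det‖ : ℝ) : ℂ) ^ 4)⁻¹ * ∫ c : ℝ × ℂ × ℝ, G (hermTwo c)) := by
          congr 1
          rw [integral_comp_hermTwo_conj hC G, Complex.real_smul, ofReal_pow, ← mul_assoc,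
            inv_mul_cancel₀ (pow_ne_zero _ (ofReal_ne_zero.2 (norm_pos_iff.2 hC).ne')), one_mul]
      _ = (1 / 8 : ℂ) * ((((‖C.det‖ : ℝ) : ℂ) ^ 4)⁻¹ * ∫ c : ℝ × ℂ × ℝ, G₂ c) := by
          simp only [hD]
          rw [integral_add_left_eq_self G₂ c₀]
      _ = (1 / 8 : ℂ) * ((((‖C.det‖ : ℝ) : ℂ) ^ 4)⁻¹ * (K₀ *
            ∫ c : ℝ × ℂ × ℝ, f (Matrix.J (Fin 2) ℂ * fromBlocks 1 (hermTwo c) 0 1 * fromBlocks R 0 0 R⁻¹) *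
              cexp (-(2 * Real.pi * I) * (h₁ * hermTwo c).trace))) := by
          rw [hG₂, integral_mul_const, mul_comm _ K₀]
      _ = (1 / 8 : ℂ) * ((((‖C.det‖ : ℝ) : ℂ) ^ 4)⁻¹ * (K₀ * (χ R⁻¹.det * (((‖R.det‖ : ℝ) : ℂ) ^ (2 - 2 * s) *
            ∫ c : ℝ × ℂ × ℝ, f (Matrix.J (Fin 2) ℂ * fromBlocks 1 (hermTwo c) 0 1) * cexp (-(2 * Real.pi * I) * (h₂ * hermTwo c).trace))))) := by
          rw [whittaker_levi_equivariance hfS had h₁, hh₂, mul_assoc (χ R⁻¹.det)]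
      _ = (1 / 8 : ℂ) * ((((‖C.det‖ : ℝ) : ℂ) ^ 4)⁻¹ * (K₀ * (χ R⁻¹.det * (((‖R.det‖ : ℝ) : ℂ) ^ (2 - 2 * s) * ∑ j ∈ J, κ j * Fj j h₂ s)))) := by
          rw [hV h₂ hh₂herm s hs₀ f hfS hfK, hJ]

end Summit.HodgeConjecture.HodgeConjecture.Cruxes.HLiu418.K2LiuKindWArchWhittakerGrowthIndefExplicit

end
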